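import Literature.GroupTheory.CombinatorialGroupTheory.RandomSclFreeGroupProofs
import HarnessLib

/-!
# Random rigidity of scl (Calegari–Walker 2013): proofs, part 6 — a lower bound for `cl` from pairings

D. Calegari, A. Walker, *Random rigidity in the free group*, Geom. Topol. 17 (2013)
[CalegariWalker2013], §3–§5: a lower bound for `scl(v)` of the order `n / log n` is certified in
§5 by a counting quasimorphism (Prop. 5.4, constant `1/12`), and the sharp constant `1/6`
(Prop. 4.9) comes from the analysis of the vertices and edges ("combs") of an extremal fatgraph.
Both rest on the same mechanism: an edge of a fatgraph bounding `v` of length `> Lm`, `L > 1`, is a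
subword of `v` of length `Lm` whose inverse also occurs in `v`, and such subwords are rare
(Prop. 2.6).

Here we prove the DETERMINISTIC letter-level core of this mechanism, via Bardakov's formula
`cl(W) = |W|/4 − max_π orb(σπ)/2 + 1/2` (`BardakovFormula_holds`):

* **`six_mul_orbitCount_le`** — a fixed-point-free permutation `τ` of `Fin N` has
  `6 · orb(τ) ≤ 2N + #{x : τ² x = x}` (2-cycles are vertices of valence 2, all others have
  valence `≥ 3`).
* **`trans_pairing_apply_ne`** — for a pairing `π` of a non-empty cyclically reduced word, `σπ` has
  no fixed point.
* **`window_inv_of_run`** — `ℓ₀` consecutive points of `{x : (σπ)² x = x}` starting at `x` form an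
  edge segment: the window `W[x, x+ℓ₀]` is the inverse of the window ending at `π x`.
* **`le_mul_card_compl_add`** — chunk counting: `N ≤ ℓ₀ · (#breakpoints + #run starts + 1)`.
* **`length_div_le_commutatorLength`** — for a non-empty cyclically reduced `W ∈ [F, F]` and
  `ℓ₀ ≥ 1`: `|W|/ℓ₀ ≤ 12 cl(W) + R + ℓ₀ − 5`, where `R` is the number of windows of length
  `ℓ₀ + 1` of `W` equal to the inverse of another such window.
-/

noncomputable section

namespace Literature.GroupTheory.CombinatorialGroupTheory

section OrbitBound

open Equiv

/-- **Valence count.** For a permutation `τ` of `Fin N` without fixed points,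
`6 · orb(τ) ≤ 2 N + #{x : τ (τ x) = x}`: every orbit has at least two points, and an orbit with
exactly two points consists of points with `τ² x = x`. [folklore] -/
theorem six_mul_orbitCount_le {N : ℕ} (τ : Equiv.Perm (Fin N)) (hτ : ∀ x, τ x ≠ x) :
    6 * orbitCount τ ≤ 2 * N + (Finset.univ.filter fun x : Fin N => τ (τ x) = x).card := by
  classical
  -- orbits = values of `cycleOf`
  set g : Fin N → Equiv.Perm (Fin N) := fun x => τ.cycleOf x with hg
  have horb : orbitCount τ = (Finset.univ.image g).card := by
    rw [← card_image_cycleLabel τ]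
    have hlab : (fun x : Fin N => (τ.cycleOf x, if τ x = x then some x else none)) =
        (fun c : Equiv.Perm (Fin N) => (c, (none : Option (Fin N)))) ∘ g := by
      funext x
      simp [hg, if_neg (hτ x)]
    rw [hlab, ← Finset.image_image, Finset.card_image_of_injective _ (fun c c' h =>
      (Prod.ext_iff.mp h).1)]
  set I := Finset.univ.image g with hI
  set fib : Equiv.Perm (Fin N) → Finset (Fin N) := fun c => Finset.univ.filter fun x => g x = c
    with hfib
  -- every fibre has ≥ 2 points; a fibre with exactly 2 points consists of `τ²`-fixed points
  have hmem_self : ∀ x, x ∈ fib (g x) := fun x => by simp [hfib]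
  have hmem_τ : ∀ x, τ x ∈ fib (g x) := fun x => by
    simp only [hfib, hg, Finset.mem_filter, Finset.mem_univ, true_and]
    exact Equiv.Perm.cycleOf_self_apply τ x
  have htwo : ∀ x, 2 ≤ (fib (g x)).card := fun x =>
    Finset.one_lt_card.mpr ⟨x, hmem_self x, τ x, hmem_τ x, (hτ x).symm⟩
  have hfix : ∀ x, (fib (g x)).card = 2 → τ (τ x) = x := by
    intro x hx
    obtain ⟨a, b, hab, hs⟩ := Finset.card_eq_two.mp hx
    have hx1 := hmem_self x
    have hx2 := hmem_τ x
    have hx3 : τ (τ x) ∈ fib (g x) := by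
      rw [show g x = g (τ x) from (Equiv.Perm.cycleOf_self_apply τ x).symm]
      exact hmem_τ (τ x)
    rw [hs, Finset.mem_insert, Finset.mem_singleton] at hx1 hx2 hx3
    have hne : τ x ≠ x := hτ x
    have hne2 : τ (τ x) ≠ τ x := fun h => hτ (τ x) h
    rcases hx3 with h3 | h3 <;> rcases hx1 with h1 | h1 <;> rcases hx2 with h2 | h2
    all_goals first
      | exact (h3.trans h1.symm)
      | exact absurd (h3.trans h2.symm) hne2
      | exact absurd (h1.trans h2.symm) hne.symm
  -- fibrewise count
  have hsum : ∑ c ∈ I, (fib c).card = N := by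
    have := Finset.card_eq_sum_card_fiberwise (s := (Finset.univ : Finset (Fin N))) (t := I)
      (f := g) (fun x _ => Finset.mem_image_of_mem g (Finset.mem_univ x))
    rw [Finset.card_univ, Fintype.card_fin] at this
    exact this.symm
  set I₂ := I.filter fun c => (fib c).card = 2 with hI₂
  have hI₂P : 2 * I₂.card ≤ (Finset.univ.filter fun x : Fin N => τ (τ x) = x).card := by
    have hdisj : (I₂ : Set (Equiv.Perm (Fin N))).PairwiseDisjoint fib := by
      intro c _ c' _ hcc'
      rw [Function.onFun, Finset.disjoint_left]
      intro x hx hx'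
      simp only [hfib, Finset.mem_filter, Finset.mem_univ, true_and] at hx hx'
      exact hcc' (hx.symm.trans hx')
    have hU : (I₂.biUnion fib).card = ∑ c ∈ I₂, (fib c).card := Finset.card_biUnion hdisj
    have hsub : I₂.biUnion fib ⊆ Finset.univ.filter fun x : Fin N => τ (τ x) = x := by
      intro x hx
      rw [Finset.mem_biUnion] at hx
      obtain ⟨c, hc, hxc⟩ := hx
      rw [hI₂, Finset.mem_filter] at hc
      simp only [hfib, Finset.mem_filter, Finset.mem_univ, true_and] at hxc
      subst hxc
      exact Finset.mem_filter.mpr ⟨Finset.mem_univ _, hfix x hc.2⟩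
    have h2 : ∑ c ∈ I₂, (fib c).card = 2 * I₂.card := by
      rw [Finset.sum_congr rfl fun c hc => (Finset.mem_filter.mp hc).2, Finset.sum_const,
        smul_eq_mul, mul_comm]
    rw [← h2, ← hU]
    exact Finset.card_le_card hsub
  -- the other fibres have ≥ 3 points
  have hI₃ : ∀ c ∈ I.filter (fun c => ¬ (fib c).card = 2), 3 ≤ (fib c).card := by
    intro c hc
    rw [Finset.mem_filter] at hc
    obtain ⟨hcI, hc2⟩ := hc
    obtain ⟨x, _, rfl⟩ := Finset.mem_image.mp hcI
    have := htwo x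
    omega
  have hsplit := Finset.card_filter_add_card_filter_not (s := I) (fun c => (fib c).card = 2)
  have hsum' : ∑ c ∈ I, (fib c).card =
      ∑ c ∈ I₂, (fib c).card + ∑ c ∈ I.filter (fun c => ¬ (fib c).card = 2), (fib c).card :=
    (Finset.sum_filter_add_sum_filter_not I (fun c => (fib c).card = 2) _).symm
  have h2 : ∑ c ∈ I₂, (fib c).card = 2 * I₂.card := by
    rw [Finset.sum_congr rfl fun c hc => (Finset.mem_filter.mp hc).2, Finset.sum_const,
      smul_eq_mul, mul_comm]
  have h3 : 3 * (I.filter (fun c => ¬ (fib c).card = 2)).card ≤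
      ∑ c ∈ I.filter (fun c => ¬ (fib c).card = 2), (fib c).card := by
    calc 3 * (I.filter (fun c => ¬ (fib c).card = 2)).card
        = ∑ _c ∈ I.filter (fun c => ¬ (fib c).card = 2), 3 := by
          rw [Finset.sum_const, smul_eq_mul, mul_comm]
      _ ≤ _ := Finset.sum_le_sum hI₃
  rw [horb]
  have hIcard : I.card = I₂.card + (I.filter (fun c => ¬ (fib c).card = 2)).card := hsplit.symm
  omega

end OrbitBound

section PairingRuns

open Equiv

/-- The reducedness criterion for a list, at consecutive numeric positions. [folklore] -/
theorem IsReduced.get_succ {α : Type*} [DecidableEq α] {W : List (α × Bool)}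
    (hW : FreeGroup.IsReduced W) (i : ℕ) (hi : i + 1 < W.length)
    (h1 : (W.get ⟨i, by omega⟩).1 = (W.get ⟨i + 1, hi⟩).1) :
    (W.get ⟨i, by omega⟩).2 = (W.get ⟨i + 1, hi⟩).2 := by
  have hchain : List.IsChain (fun a b : α × Bool => a.1 = b.1 → a.2 = b.2) W := hW
  have := List.isChain_iff_getElem.mp hchain i hi
  simp only [List.get_eq_getElem] at h1 ⊢
  exact this h1

/-- **No fixed points.** For a pairing `π` of a non-empty cyclically reduced word `W`, the vertex
permutation `x ↦ π (x + 1)` has no fixed point (a fixed point is a pair of adjacent, or last/first,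
letters which cancel). [folklore] -/
theorem trans_pairing_apply_ne {α : Type*} [DecidableEq α] (W : List (α × Bool))
    (hW : FreeGroup.IsCyclicallyReduced W) (π : Equiv.Perm (Fin W.length)) (hπ : IsPairing W π)
    (x : Fin W.length) : ((finRotate W.length).trans π) x ≠ x := by
  intro hx
  rw [Equiv.trans_apply] at hx
  have hN : 0 < W.length := Fin.pos x
  -- the letters at `x` and `x + 1` (cyclically) cancel
  have hletter := hπ.2.2 (finRotate _ x)
  rw [hx] at hletter
  have hval := val_finRotate hN x
  by_cases hlast : (x : ℕ) + 1 < W.length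
  · rw [Nat.mod_eq_of_lt hlast] at hval
    have e : finRotate _ x = ⟨(x : ℕ) + 1, hlast⟩ := Fin.ext hval
    rw [e] at hletter
    have h1' := congrArg Prod.fst hletter
    have h1 : (W.get ⟨(x : ℕ), by omega⟩).1 = (W.get ⟨(x : ℕ) + 1, hlast⟩).1 := h1'
    have h2 := IsReduced.get_succ hW.1 x hlast h1
    have h3' := congrArg Prod.snd hletter
    have h3 : (W.get ⟨(x : ℕ), by omega⟩).2 = !(W.get ⟨(x : ℕ) + 1, hlast⟩).2 := h3'
    rw [h2] at h3
    simp at h3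
  · -- `x` is the last letter and `x + 1` the first
    have hxN : (x : ℕ) + 1 = W.length := by omega
    rw [hxN, Nat.mod_self] at hval
    have e : finRotate _ x = ⟨0, hN⟩ := Fin.ext hval
    rw [e] at hletter
    have hlast' : W.getLast? = some (W.get x) := by
      rw [List.getLast?_eq_getElem?, List.getElem?_eq_getElem (by omega)]
      congr 1
      simp only [List.get_eq_getElem]
      congr 1
      omega
    have hhead : W.head? = some (W.get ⟨0, hN⟩) := by
      rw [List.head?_eq_getElem?, List.getElem?_eq_getElem hN]
      rfl
    have hcyc := hW.2 (W.get x) (by rw [hlast']; rfl) (W.get ⟨0, hN⟩) (by rw [hhead]; rfl)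
    rw [hletter] at hcyc
    simp at hcyc

/-- **Runs of 2-cycles are edge segments.** Let `π` be a pairing of `W`, `τ = (x ↦ π(x+1))`,
`ℓ₀ ≥ 0`, and `x` a position with `x + ℓ₀ < |W|` such that `τ² (x + t) = x + t` for all
`t < ℓ₀` and `π x ≥ ℓ₀`. Then `π (x + t) = π x − t` for `t ≤ ℓ₀`, so the window `W[x, x + ℓ₀]`
is the inverse of the window `W[π x − ℓ₀, π x]`. [cite: CalegariWalker2013, §4.5 (edges of the
fatgraph are matched pairs of subwords)] -/
theorem window_inv_of_run {α : Type*} [DecidableEq α] (W : List (α × Bool))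
    (π : Equiv.Perm (Fin W.length)) (hπ : IsPairing W π) (ℓ₀ x : ℕ) (hx : x + ℓ₀ < W.length)
    (hrun : ∀ t (ht : t < ℓ₀), ((finRotate W.length).trans π)
      (((finRotate W.length).trans π) ⟨x + t, by omega⟩) = ⟨x + t, by omega⟩)
    (hfar : ℓ₀ ≤ (π ⟨x, by omega⟩ : ℕ)) :
    ∀ q : Fin (ℓ₀ + 1), W.get ⟨x + q, by omega⟩ =
      ((W.get ⟨((π ⟨x, by omega⟩ : ℕ) - ℓ₀) + (ℓ₀ - q), by omega⟩).1,
        !(W.get ⟨((π ⟨x, by omega⟩ : ℕ) - ℓ₀) + (ℓ₀ - q), by omega⟩).2) := by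
  have hN : 0 < W.length := by omega
  -- the partners descend
  have hdesc : ∀ t (ht : t ≤ ℓ₀), ((π ⟨x + t, by omega⟩ : Fin W.length) : ℕ) =
      (π ⟨x, by omega⟩ : ℕ) - t := by
    intro t
    induction t with
    | zero => intro _; rfl
    | succ t ih =>
      intro ht
      have ih' := ih (by omega)
      have hr := hrun t (by omega)
      rw [Equiv.trans_apply, Equiv.trans_apply] at hr
      -- `fr (x + t) = x + t + 1`
      have e1 : (finRotate W.length) ⟨x + t, by omega⟩ = ⟨x + t + 1, by omega⟩ := by
        apply Fin.ext
        rw [val_finRotate hN]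
        exact Nat.mod_eq_of_lt (by simp only; omega)
      rw [e1] at hr
      -- apply `π` (an involution): `fr (π (x+t+1)) = π (x+t)`
      have hr' : (finRotate W.length) (π ⟨x + t + 1, by omega⟩) = π ⟨x + t, by omega⟩ := by
        rw [← hr, hπ.1]
      have hv := congrArg Fin.val hr'
      rw [val_finRotate hN] at hv
      rw [ih'] at hv
      -- no wrap-around, since `π (x + t) ≥ 1`
      have hp := (π ⟨x + t + 1, by omega⟩).isLt
      by_cases hwrap : ((π ⟨x + t + 1, by omega⟩ : Fin W.length) : ℕ) + 1 < W.length
      · rw [Nat.mod_eq_of_lt hwrap] at hv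
        show ((π ⟨x + (t + 1), by omega⟩ : Fin W.length) : ℕ) = _
        have e2 : (⟨x + (t + 1), by omega⟩ : Fin W.length) = ⟨x + t + 1, by omega⟩ :=
          Fin.ext (by simp only; omega)
        rw [e2]
        omega
      · have heq : ((π ⟨x + t + 1, by omega⟩ : Fin W.length) : ℕ) + 1 = W.length := by omega
        rw [heq, Nat.mod_self] at hv
        omega
  intro q
  have hq := q.isLt
  have hletter := hπ.2.2 ⟨x + q, by omega⟩
  have hidx : π ⟨x + q, by omega⟩ =
      ⟨((π ⟨x, by omega⟩ : ℕ) - ℓ₀) + (ℓ₀ - q), by omega⟩ := by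
    apply Fin.ext
    rw [hdesc q (by omega)]
    simp only
    omega
  rw [hidx] at hletter
  rw [hletter]
  simp

end PairingRuns

section ChunkCount

/-- **Chunk counting.** For `ℓ₀ ≥ 1` and any property `P` of positions: cutting `[0, N)` into
consecutive chunks of length `ℓ₀`, every chunk contains a position where `P` fails, or is a run of
`ℓ₀` positions satisfying `P` starting below `N − ℓ₀`, or is the last chunk. Hence
`N ≤ ℓ₀ · (#{x < N : ¬P x} + #{s < N − ℓ₀ : P s, …, P (s + ℓ₀ − 1)} + 1)`. [folklore] -/
theorem le_mul_card_compl_add (N ℓ₀ : ℕ) (hℓ : 1 ≤ ℓ₀) (P : ℕ → Prop) [DecidablePred P] :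
    N ≤ ℓ₀ * (((Finset.range N).filter fun x => ¬ P x).card +
      ((Finset.range (N - ℓ₀)).filter fun s => ∀ t, t < ℓ₀ → P (s + t)).card + 1) := by
  classical
  set Q := (N + ℓ₀ - 1) / ℓ₀ with hQ
  have hNQ : N ≤ ℓ₀ * Q := by
    have h1 := Nat.div_add_mod (N + ℓ₀ - 1) ℓ₀
    have h2 := Nat.mod_lt (N + ℓ₀ - 1) (show 0 < ℓ₀ by omega)
    rw [← hQ] at h1
    omega
  have hQle : ∀ q, q < Q → q * ℓ₀ < N := by
    intro q hq
    have := (Nat.lt_div_iff_mul_lt (show 0 < ℓ₀ by omega)).mp (hQ ▸ hq)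
    omega
  -- classify the chunks
  set A := (Finset.range Q).filter fun q => ∃ x, q * ℓ₀ ≤ x ∧ x < q * ℓ₀ + ℓ₀ ∧ x < N ∧ ¬ P x
    with hA
  set B := (Finset.range Q).filter fun q =>
      (¬ ∃ x, q * ℓ₀ ≤ x ∧ x < q * ℓ₀ + ℓ₀ ∧ x < N ∧ ¬ P x) ∧ q * ℓ₀ + ℓ₀ < N with hB
  set C := (Finset.range Q).filter fun q => N ≤ q * ℓ₀ + ℓ₀ with hC
  have hcover : Finset.range Q ⊆ A ∪ B ∪ C := by
    intro q hq
    rw [Finset.mem_union, Finset.mem_union]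
    by_cases hA' : ∃ x, q * ℓ₀ ≤ x ∧ x < q * ℓ₀ + ℓ₀ ∧ x < N ∧ ¬ P x
    · exact Or.inl (Or.inl (Finset.mem_filter.mpr ⟨hq, hA'⟩))
    · by_cases hC' : N ≤ q * ℓ₀ + ℓ₀
      · exact Or.inr (Finset.mem_filter.mpr ⟨hq, hC'⟩)
      · exact Or.inl (Or.inr (Finset.mem_filter.mpr ⟨hq, hA', by omega⟩))
  -- chunks with a breakpoint inject (via the breakpoint's chunk index) into the breakpoints
  have hAcard : A.card ≤ ((Finset.range N).filter fun x => ¬ P x).card := by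
    have hsub : A ⊆ ((Finset.range N).filter fun x => ¬ P x).image fun x => x / ℓ₀ := by
      intro q hq
      rw [hA, Finset.mem_filter] at hq
      obtain ⟨_, x, hx1, hx2, hxN, hxP⟩ := hq
      rw [Finset.mem_image]
      refine ⟨x, Finset.mem_filter.mpr ⟨Finset.mem_range.mpr hxN, hxP⟩, ?_⟩
      exact Nat.div_eq_of_lt_le hx1 (by rw [Nat.succ_mul]; exact hx2)
    exact (Finset.card_le_card hsub).trans Finset.card_image_le
  -- good chunks are run starts
  have hBcard : B.card ≤ ((Finset.range (N - ℓ₀)).filter fun s => ∀ t, t < ℓ₀ → P (s + t)).card := by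
    refine Finset.card_le_card_of_injOn (fun q => q * ℓ₀) ?_ ?_
    · intro q hq
      rw [Finset.mem_coe, hB, Finset.mem_filter] at hq
      obtain ⟨_, hno, hlt⟩ := hq
      rw [Finset.mem_coe, Finset.mem_filter, Finset.mem_range]
      refine ⟨?_, fun t ht => ?_⟩
      · show q * ℓ₀ < N - ℓ₀
        omega
      by_contra hPt
      exact hno ⟨q * ℓ₀ + t, by omega, by omega, by omega, hPt⟩
    · intro q _ q' _ h
      exact Nat.eq_of_mul_eq_mul_right (by omega) h
  -- at most one chunk sticks out
  have hCcard : C.card ≤ 1 := by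
    refine Finset.card_le_one.mpr fun q hq q' hq' => ?_
    rw [hC, Finset.mem_filter, Finset.mem_range] at hq hq'
    have h1 : ∀ r, r < Q → N ≤ r * ℓ₀ + ℓ₀ → Q ≤ r + 1 := by
      intro r _ hr
      rw [hQ, Nat.div_le_iff_le_mul_add_pred (show 0 < ℓ₀ by omega)]
      have : ℓ₀ * (r + 1) = r * ℓ₀ + ℓ₀ := by ring
      omega
    have := h1 q hq.1 hq.2
    have := h1 q' hq'.1 hq'.2
    omega
  have hQcard : Q ≤ ((Finset.range N).filter fun x => ¬ P x).card +
      ((Finset.range (N - ℓ₀)).filter fun s => ∀ t, t < ℓ₀ → P (s + t)).card + 1 := by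
    calc Q = (Finset.range Q).card := (Finset.card_range Q).symm
      _ ≤ (A ∪ B ∪ C).card := Finset.card_le_card hcover
      _ ≤ A.card + B.card + C.card :=
          (Finset.card_union_le _ _).trans (by
            have := Finset.card_union_le A B; omega)
      _ ≤ _ := by omega
  calc N ≤ ℓ₀ * Q := hNQ
    _ ≤ _ := Nat.mul_le_mul_left ℓ₀ hQcard

end ChunkCount


section Assembly

open Equiv

/-- The assembly step of `length_div_le_commutatorLength`, generic in the decidability instance
used to enumerate the pairings (so that it applies verbatim to the set of pairings appearing in
`BardakovFormula`). [folklore] -/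
theorem length_div_le_commutatorLength_aux {α : Type*} [DecidableEq α] (W : List (α × Bool))
    (hW : FreeGroup.IsCyclicallyReduced W) {inst : DecidablePred (IsPairing W)}
    (hB : (commutatorLength (FreeGroup.mk W) : ℚ) = (W.length : ℚ) / 4 -
      (((@Finset.filter _ (IsPairing W) inst Finset.univ).sup
        fun π => orbitCount ((finRotate W.length).trans π) : ℕ) : ℚ) / 2 + 1 / 2)
    (hne : ∃ π, IsPairing W π) (ℓ₀ : ℕ) (hℓ : 1 ≤ ℓ₀) :
    (W.length : ℚ) / ℓ₀ ≤ 12 * (commutatorLength (FreeGroup.mk W) : ℚ) +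
      ((Finset.univ : Finset (Fin (W.length - ℓ₀))).filter fun i : Fin (W.length - ℓ₀) =>
        ∃ i' : Fin (W.length - ℓ₀), ∀ q : Fin (ℓ₀ + 1), W.get ⟨i + q, by omega⟩ =
          ((W.get ⟨i' + (ℓ₀ - q), by omega⟩).1, !(W.get ⟨i' + (ℓ₀ - q), by omega⟩).2)).card +
      ℓ₀ - 5 := by
  classical
  -- the inverse-repeat positions
  set R := ((Finset.univ : Finset (Fin (W.length - ℓ₀))).filter fun i : Fin (W.length - ℓ₀) =>
      ∃ i' : Fin (W.length - ℓ₀), ∀ q : Fin (ℓ₀ + 1), W.get ⟨i + q, by omega⟩ =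
        ((W.get ⟨i' + (ℓ₀ - q), by omega⟩).1, !(W.get ⟨i' + (ℓ₀ - q), by omega⟩).2)) with hR
  -- an optimal pairing
  have hne' : (@Finset.filter _ (IsPairing W) inst Finset.univ).Nonempty := by
    obtain ⟨π, hπ⟩ := hne
    exact ⟨π, (@Finset.mem_filter _ (IsPairing W) inst Finset.univ π).mpr ⟨Finset.mem_univ _, hπ⟩⟩
  obtain ⟨π, hπS, hsup⟩ := Finset.exists_mem_eq_sup _ hne'
    (fun π => orbitCount ((finRotate W.length).trans π))
  rw [hsup] at hB
  have hπ : IsPairing W π := ((@Finset.mem_filter _ (IsPairing W) inst Finset.univ π).mp hπS).2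
  set τ : Equiv.Perm (Fin W.length) := (finRotate W.length).trans π with hτ
  -- valence count
  have hτfix : ∀ x, τ x ≠ x := trans_pairing_apply_ne W hW π hπ
  have horb := six_mul_orbitCount_le τ hτfix
  -- positions as naturals: the `τ²`-fixed property
  let P : ℕ → Prop := fun y => ∃ h : y < W.length, τ (τ ⟨y, h⟩) = ⟨y, h⟩
  have hPcard : (Finset.univ.filter fun x : Fin W.length => τ (τ x) = x).card =
      ((Finset.range W.length).filter P).card := by
    refine Finset.card_bij (fun x _ => (x : ℕ)) ?_ ?_ ?_
    · intro x hx
      rw [Finset.mem_filter] at hx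
      exact Finset.mem_filter.mpr ⟨Finset.mem_range.mpr x.isLt, x.isLt, hx.2⟩
    · intro x _ y _ h
      exact Fin.ext h
    · intro y hy
      rw [Finset.mem_filter, Finset.mem_range] at hy
      obtain ⟨hy, hy', hP⟩ := hy
      exact ⟨⟨y, hy⟩, Finset.mem_filter.mpr ⟨Finset.mem_univ _, hP⟩, rfl⟩
  have hsplit := Finset.card_filter_add_card_filter_not (s := Finset.range W.length) P
  rw [Finset.card_range] at hsplit
  -- chunk counting
  have hchunk := le_mul_card_compl_add W.length ℓ₀ hℓ P
  set RS := (Finset.range (W.length - ℓ₀)).filter fun s => ∀ t, t < ℓ₀ → P (s + t) with hRS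
  -- run starts are few: either `π s < ℓ₀` (at most `ℓ₀` of them) or an inverse repeat
  have hruns : RS.card ≤ ℓ₀ + R.card := by
    let val : ℕ → ℕ := fun s => if h : s < W.length then ((π ⟨s, h⟩ : Fin W.length) : ℕ) else 0
    have hsplit' := Finset.card_filter_add_card_filter_not (s := RS) (fun s => val s < ℓ₀)
    -- the near ones
    have hnear : (RS.filter fun s => val s < ℓ₀).card ≤ ℓ₀ := by
      have h := Finset.card_le_card_of_injOn val (s := RS.filter fun s => val s < ℓ₀)
        (t := Finset.range ℓ₀) ?_ ?_
      · rwa [Finset.card_range] at h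
      · intro s hs
        rw [Finset.mem_coe, Finset.mem_filter] at hs
        exact Finset.mem_coe.mpr (Finset.mem_range.mpr hs.2)
      · intro s hs s' hs' h
        rw [Finset.mem_coe, Finset.mem_filter, hRS, Finset.mem_filter, Finset.mem_range] at hs hs'
        have hsN : s < W.length := by omega
        have hs'N : s' < W.length := by omega
        simp only [val, dif_pos hsN, dif_pos hs'N] at h
        have := π.injective (Fin.ext h)
        simpa using this
    -- the far ones are inverse repeats
    have hfarcard : (RS.filter fun s => ¬ val s < ℓ₀).card ≤ R.card := by
      have hsub : (RS.filter fun s => ¬ val s < ℓ₀) ⊆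
          R.image (fun i : Fin (W.length - ℓ₀) => (i : ℕ)) := by
        intro s hs
        rw [Finset.mem_filter, hRS, Finset.mem_filter, Finset.mem_range] at hs
        obtain ⟨⟨hslt, hrunP⟩, hfar⟩ := hs
        have hsN : s + ℓ₀ < W.length := by omega
        have hsN' : s < W.length := by omega
        rw [not_lt] at hfar
        simp only [val, dif_pos hsN'] at hfar
        have hrun : ∀ t (ht : t < ℓ₀), τ (τ ⟨s + t, by omega⟩) = ⟨s + t, by omega⟩ := by
          intro t ht
          obtain ⟨h, e⟩ := hrunP t ht
          exact e
        have hwin := window_inv_of_run W π hπ ℓ₀ s hsN hrun hfar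
        rw [Finset.mem_image]
        refine ⟨⟨s, hslt⟩, ?_, rfl⟩
        rw [hR, Finset.mem_filter]
        refine ⟨Finset.mem_univ _, ⟨((π ⟨s, hsN'⟩ : Fin W.length) : ℕ) - ℓ₀, by omega⟩, fun q => ?_⟩
        exact hwin q
      exact (Finset.card_le_card hsub).trans Finset.card_image_le
    omega
  -- arithmetic, in `ℚ`
  show (W.length : ℚ) / ℓ₀ ≤ 12 * (commutatorLength (FreeGroup.mk W) : ℚ) + (R.card : ℚ) + ℓ₀ - 5
  have hℓq : (0 : ℚ) < ℓ₀ := by exact_mod_cast (show 0 < ℓ₀ by omega)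
  rw [div_le_iff₀ hℓq]
  have h1 : (W.length : ℚ) ≤ (ℓ₀ : ℚ) *
      ((((Finset.range W.length).filter fun x => ¬ P x).card : ℚ) + (RS.card : ℚ) + 1) := by
    exact_mod_cast hchunk
  have h2 : (RS.card : ℚ) ≤ (ℓ₀ : ℚ) + (R.card : ℚ) := by exact_mod_cast hruns
  have h3 : 6 * (orbitCount τ : ℚ) ≤ 2 * (W.length : ℚ) +
      ((Finset.univ.filter fun x : Fin W.length => τ (τ x) = x).card : ℚ) := by
    exact_mod_cast horb
  have h4 : ((((Finset.range W.length).filter P).card : ℕ) : ℚ) +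
      (((Finset.range W.length).filter fun x => ¬ P x).card : ℚ) = W.length := by
    exact_mod_cast hsplit
  have h5 : (((Finset.univ.filter fun x : Fin W.length => τ (τ x) = x).card : ℕ) : ℚ) =
      (((Finset.range W.length).filter P).card : ℚ) := by
    exact_mod_cast hPcard
  have hnotP : ((((Finset.range W.length).filter fun x => ¬ P x).card : ℕ) : ℚ) ≤
      12 * (commutatorLength (FreeGroup.mk W) : ℚ) - 6 := by
    linarith
  have e1 := mul_le_mul_of_nonneg_left hnotP hℓq.le
  have e2 := mul_le_mul_of_nonneg_left h2 hℓq.le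
  nlinarith

/-- **A lower bound for commutator length from inverse repeats.** Let `W` be a non-empty
cyclically reduced word in the commutator subgroup and `ℓ₀ ≥ 1`. Then
`|W| / ℓ₀ ≤ 12 · cl(W) + R + ℓ₀ − 5`, where `R` is the number of positions `i < |W| − ℓ₀` whose
window `W[i, i + ℓ₀]` is the inverse of another such window. (By Bardakov's formula
`cl = |W|/4 − orb/2 + 1/2` for an optimal pairing; its vertex permutation has `≥ 3` points per
orbit except along runs of matched subword pairs, and a run of length `ℓ₀` is an inverse repeat.)
[cite: CalegariWalker2013, §4.5–§4.7 and Prop. 5.4 (mechanism); Heuer2020, Thm 2.4 (formula)] -/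
theorem length_div_le_commutatorLength {α : Type} [DecidableEq α] (W : List (α × Bool))
    (hW0 : W ≠ []) (hW : FreeGroup.IsCyclicallyReduced W)
    (hcomm : FreeGroup.mk W ∈ commutator (FreeGroup α)) (ℓ₀ : ℕ) (hℓ : 1 ≤ ℓ₀) :
    (W.length : ℚ) / ℓ₀ ≤ 12 * (commutatorLength (FreeGroup.mk W) : ℚ) +
      ((Finset.univ : Finset (Fin (W.length - ℓ₀))).filter fun i : Fin (W.length - ℓ₀) =>
        ∃ i' : Fin (W.length - ℓ₀), ∀ q : Fin (ℓ₀ + 1), W.get ⟨i + q, by omega⟩ =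
          ((W.get ⟨i' + (ℓ₀ - q), by omega⟩).1, !(W.get ⟨i' + (ℓ₀ - q), by omega⟩).2)).card +
      ℓ₀ - 5 :=
  length_div_le_commutatorLength_aux W hW (BardakovFormula_holds α W hW0 hW hcomm)
    (exists_isPairing_of_mk_mem_commutator W hcomm) ℓ₀ hℓ

end Assembly

end Literature.GroupTheory.CombinatorialGroupTheory

end
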